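import Summits.ResolutionOfSingularities.ResolutionOfSingularities.Theorems.PAlterationPialtPiAssembly
import Summits.ResolutionOfSingularities.ResolutionOfSingularities.Theorems.PAlterationPialtPiTwoModelPatchingOfPialt
import HarnessLib

/-!
# Crux `Pialt` (stmt-ResolutionOfSingularities-0555), PiTMP programme: EXACTNESS by name — `Pialt ⟺ PiTMP` modulo `Temkin2013`

Line lead c5 (prover-line-stmt-ResolutionOfSingularities-0555-c5-0, 2026-08-17). The two landed directions
`PiPatching.pialt_of_temkin2013_piTwoModelPatching` (p152878) and `piTwoModelPatching_of_pialt` (p152248) combined into the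
registered by-name statement `pialt_iff_piTwoModelPatching`: modulo Temkin's inseparable local uniformization theorem
(Temkin 2013, Thm. 1.3.2 — a published theorem, named fact `Temkin2013`), the Abramovich–Oort conjecture in characteristic `p`
(`Pialt`) is EQUIVALENT to purely inseparable two-model patching in every prime characteristic.
-/

set_option linter.dupNamespace false

noncomputable section

open CategoryTheory AlgebraicGeometry
open Literature.AlgebraicGeometry.Resolution
open Summit.ResolutionOfSingularities.ResolutionOfSingularities.Theses.PAlteration (Pialt)

namespace Summit.ResolutionOfSingularities.ResolutionOfSingularities.Theorems.Pialt.RadiciallyRegular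

/-! ## Exactness (landed): the residual is EQUIVALENT to the crux modulo `Temkin2013` -/

/-- **`Pialt ⟺ purely inseparable two-model patching in every prime characteristic`, modulo Temkin's theorem**
(both directions landed: `PiPatching.pialt_of_temkin2013_piTwoModelPatching`, `piTwoModelPatching_of_pialt`).
[cite: Temkin2013, Conj. 1.3.1 and Thm. 1.3.2] [cite: Piltant2013, Prop. 5.1] -/
theorem pialt_iff_piTwoModelPatching (hT : Temkin2013.{0}) :
    Pialt ↔ ∀ p : ℕ, p.Prime → ∀ (k : Type) [Field k] [CharP k p] (K : Type) [Field K] [Algebra k K]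
      (L₁ : Type) [Field L₁] [Algebra K L₁] [Algebra k L₁] [IsScalarTower k K L₁]
      [FiniteDimensional K L₁] [IsPurelyInseparable K L₁]
      (L₂ : Type) [Field L₂] [Algebra K L₂] [Algebra k L₂] [IsScalarTower k K L₂]
      [FiniteDimensional K L₂] [IsPurelyInseparable K L₂]
      (M₁ : ProperModel k L₁) (M₂ : ProperModel k L₂),
      ∃ (L : Type) (_ : Field L) (_ : Algebra K L) (_ : Algebra k L) (_ : IsScalarTower k K L)
        (ι₁ : L₁ →ₐ[K] L) (ι₂ : L₂ →ₐ[K] L),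
        FiniteDimensional K L ∧ IsPurelyInseparable K L ∧
        ∃ (N : ProperModel k L) (φ₁ : N.X ⟶ M₁.X) (φ₂ : N.X ⟶ M₂.X),
          φ₁ ≫ M₁.π = N.π ∧ φ₂ ≫ M₂.π = N.π ∧
          N.gen ≫ φ₁ = Spec.map (CommRingCat.ofHom ι₁.toRingHom) ≫ M₁.gen ∧
          N.gen ≫ φ₂ = Spec.map (CommRingCat.ofHom ι₂.toRingHom) ≫ M₂.gen ∧
          ∀ n : N.X, (IsRegularLocalRing (M₁.X.presheaf.stalk (φ₁.base n)) ∨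
              IsRegularLocalRing (M₂.X.presheaf.stalk (φ₂.base n))) →
            IsRegularLocalRing (N.X.presheaf.stalk n) :=
  ⟨fun h p hp => piTwoModelPatching_of_pialt h p hp, PiPatching.pialt_of_temkin2013_piTwoModelPatching hT⟩


end Summit.ResolutionOfSingularities.ResolutionOfSingularities.Theorems.Pialt.RadiciallyRegular

end
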